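import Literature.Barriers.MatrixMultiplication.TricoloredSumFreeBarrier
import HarnessLib

/-!
# Tri-budget slice decompositions (slices counted per direction)

Topic `Literature/Barriers/MatrixMultiplication`; first file of the PROOF of the numerical table
`CLLZ2025_omegaTwo_barrier_CW` (Christandl–Le Gall–Lysikov–Zuiddam 2025, Table 1) of
`RectangularBarrier.lean`. The printed proof of that table goes through Strassen's upper support
functionals (Lemma 4.1, Lemma 4.2 there), whose theory (Strassen 1991) is not in the tree; the proof
formalised in this series of files replaces them by an elementary *weighted slice-rank* argument:
a tensor `D : X → Y → Z → K` has an `(r₁, r₂, r₃)`-slice decomposition if it is a sum of `r₁`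
tensors of `x`-rank one, `r₂` of `y`-rank one and `r₃` of `z`-rank one (the three budgets are kept
separate, whereas the slice rank of Tao / BCCGNSU 2017 (4.1), the tree's `HasSliceRankLE` and
`sliceRank`, only records `r₁ + r₂ + r₃`). This file: the definition and its formal properties —
monotonicity under restriction, reindexing, and the covering construction from a three-colouring of
a rank-one decomposition (the pattern of `hasSliceRankLE_of_cover`, BCCGNSU 2017, proof of
Thm. 4.10). Everything is PROVED.

## Content

* `HasSliceDecomp D r₁ r₂ r₃`; `HasSliceDecomp.hasSliceRankLE` (bridge to `HasSliceRankLE`);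
  `hasSliceDecomp_of_fintype` (arbitrary finite index types); `HasSliceDecomp.comp` (pull back along
  coordinate maps); `HasSliceDecomp.of_restrictsTo` (**monotone under restriction**,
  `TensorRestrictsTo t s → HasSliceDecomp t r₁ r₂ r₃ → HasSliceDecomp s r₁ r₂ r₃`, by the tree's
  `sliceDecomposition_map`); `hasSliceDecomp_of_cover` (**covering lemma** with separate budgets
  `|Sx|, |Sy|, |Sz|`).

## References

* Blasiak–Church–Cohn–Grochow–Naslund–Sawin–Umans, *On cap sets and the group-theoretic approach to
  matrix multiplication*, Discrete Analysis 2017:3, §4.1 (4.1) and proof of Thm. 4.10.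
  [BlasiakChurchCohnGrochowNaslundSawinUmans2017]
* M. Christandl, F. Le Gall, V. Lysikov, J. Zuiddam, *Barriers for rectangular matrix
  multiplication*, comput. complexity 34 (2025) = arXiv:2003.03019, §4.4 Table 1 (the statement this
  series proves). [ChristandlLeGallLysikovZuiddam2025]
-/

noncomputable section

open scoped BigOperators

namespace Literature.Barriers.MatrixMultiplication

open Literature.Computability.AlgebraicComplexity Literature.Combinatorics.Additive Finset

universe u

section Defs

variable {K : Type u} [CommSemiring K]
variable {X Y Z : Type*}

/-- **`(r₁, r₂, r₃)`-slice decomposition**: `D(x,y,z) = Σ_{r<r₁} f₁ʳ(x) g₁ʳ(y,z) +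
Σ_{r<r₂} f₂ʳ(y) g₂ʳ(x,z) + Σ_{r<r₃} f₃ʳ(z) g₃ʳ(x,y)` — the slice decompositions of BCCGNSU 2017,
(4.1), with the numbers of `x`-, `y`- and `z`-slices recorded separately.
[cite: BlasiakChurchCohnGrochowNaslundSawinUmans2017, §4.1 (4.1)] -/
def HasSliceDecomp (D : X → Y → Z → K) (r₁ r₂ r₃ : ℕ) : Prop :=
  ∃ (f₁ : Fin r₁ → X → K) (g₁ : Fin r₁ → Y → Z → K) (f₂ : Fin r₂ → Y → K)
    (g₂ : Fin r₂ → X → Z → K) (f₃ : Fin r₃ → Z → K) (g₃ : Fin r₃ → X → Y → K),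
    ∀ x y z, D x y z =
      (∑ r, f₁ r x * g₁ r y z) + (∑ r, f₂ r y * g₂ r x z) + (∑ r, f₃ r z * g₃ r x y)

/-- A tri-budget decomposition indexed by arbitrary finite types `R₁, R₂, R₃` witnesses
`HasSliceDecomp D |R₁| |R₂| |R₃|` (reindex along `Fintype.equivFin`). [folklore] -/
theorem hasSliceDecomp_of_fintype {R₁ R₂ R₃ : Type*} [Fintype R₁] [Fintype R₂] [Fintype R₃]
    (D : X → Y → Z → K) (f₁ : R₁ → X → K) (g₁ : R₁ → Y → Z → K) (f₂ : R₂ → Y → K)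
    (g₂ : R₂ → X → Z → K) (f₃ : R₃ → Z → K) (g₃ : R₃ → X → Y → K)
    (hD : ∀ x y z, D x y z =
      (∑ r, f₁ r x * g₁ r y z) + (∑ r, f₂ r y * g₂ r x z) + (∑ r, f₃ r z * g₃ r x y)) :
    HasSliceDecomp D (Fintype.card R₁) (Fintype.card R₂) (Fintype.card R₃) := by
  classical
  set e₁ := Fintype.equivFin R₁
  set e₂ := Fintype.equivFin R₂
  set e₃ := Fintype.equivFin R₃
  refine ⟨fun r => f₁ (e₁.symm r), fun r => g₁ (e₁.symm r), fun r => f₂ (e₂.symm r),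
    fun r => g₂ (e₂.symm r), fun r => f₃ (e₃.symm r), fun r => g₃ (e₃.symm r), fun x y z => ?_⟩
  rw [hD x y z]
  congr 1
  congr 1
  · exact (e₁.symm.sum_comp (fun r => f₁ r x * g₁ r y z)).symm
  · exact (e₂.symm.sum_comp (fun r => f₂ r y * g₂ r x z)).symm
  · exact (e₃.symm.sum_comp (fun r => f₃ r z * g₃ r x y)).symm

/-- Tri-budget decompositions pull back along arbitrary maps of the three coordinates (in
particular along relabellings and to sub-boxes). [cite: BlasiakChurchCohnGrochowNaslundSawinUmans2017, Prop. 4.8 (proof)] -/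
theorem HasSliceDecomp.comp {D : X → Y → Z → K} {r₁ r₂ r₃ : ℕ} (h : HasSliceDecomp D r₁ r₂ r₃)
    {X' Y' Z' : Type*} (φ : X' → X) (ψ : Y' → Y) (χ : Z' → Z) :
    HasSliceDecomp (fun x y z => D (φ x) (ψ y) (χ z)) r₁ r₂ r₃ := by
  obtain ⟨f₁, g₁, f₂, g₂, f₃, g₃, hD⟩ := h
  exact ⟨fun r x => f₁ r (φ x), fun r y z => g₁ r (ψ y) (χ z), fun r y => f₂ r (ψ y),
    fun r x z => g₂ r (φ x) (χ z), fun r z => f₃ r (χ z), fun r x y => g₃ r (φ x) (ψ y),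
    fun x y z => hD _ _ _⟩

/-- **Monotonicity under restriction**: if `t ≥ s` (the tree's `TensorRestrictsTo`: `s = (A ⊗ B ⊗ C)·t`
entrywise) then every `(r₁,r₂,r₃)`-slice decomposition of `t` is mapped to one of `s` — an `x`-slice
`f(x) g(y,z)` goes to the `x`-slice `(Af)(x') · ((B ⊗ C)g)(y',z')`, and similarly in the other two
directions (the computation `sliceDecomposition_map` of `TricoloredSumFreeBarrier.lean`).
[cite: BlasiakChurchCohnGrochowNaslundSawinUmans2017, Prop. 4.8 (proof)] -/
theorem HasSliceDecomp.of_restrictsTo [Fintype X] [Fintype Y] [Fintype Z] {X' Y' Z' : Type*}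
    {t : X → Y → Z → K} {s : X' → Y' → Z' → K} (hts : TensorRestrictsTo t s) {r₁ r₂ r₃ : ℕ}
    (ht : HasSliceDecomp t r₁ r₂ r₃) : HasSliceDecomp s r₁ r₂ r₃ := by
  obtain ⟨f₁, g₁, f₂, g₂, f₃, g₃, hD⟩ := ht
  obtain ⟨A, B, C, hs⟩ := hts
  refine ⟨fun i a' => ∑ a, A a' a * f₁ i a, fun i b' c' => ∑ b, ∑ c, B b' b * C c' c * g₁ i b c,
    fun i b' => ∑ b, B b' b * f₂ i b, fun i a' c' => ∑ a, ∑ c, A a' a * C c' c * g₂ i a c,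
    fun i c' => ∑ c, C c' c * f₃ i c, fun i a' b' => ∑ a, ∑ b, A a' a * B b' b * g₃ i a b,
    fun a' b' c' => ?_⟩
  rw [hs a' b' c', ← sliceDecomposition_map f₁ g₁ f₂ g₂ f₃ g₃ A B C a' b' c']
  simp_rw [hD]

end Defs

section FieldFacts

variable {K : Type u} [Field K]
variable {X Y Z : Type*}

/-- Bridge: an `(r₁,r₂,r₃)`-slice decomposition is a slice decomposition with `r₁ + r₂ + r₃` slices
in the sense of `HasSliceRankLE`. [cite: BlasiakChurchCohnGrochowNaslundSawinUmans2017, §4.1 (4.1)] -/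
theorem HasSliceDecomp.hasSliceRankLE {D : X → Y → Z → K} {r₁ r₂ r₃ : ℕ}
    (h : HasSliceDecomp D r₁ r₂ r₃) : HasSliceRankLE D (r₁ + r₂ + r₃) := by
  obtain ⟨f₁, g₁, f₂, g₂, f₃, g₃, hD⟩ := h
  exact ⟨r₁, r₂, r₃, le_rfl, f₁, g₁, f₂, g₂, f₃, g₃, hD⟩

/-- **Covering lemma with separate budgets** (the construction of BCCGNSU 2017, proof of Thm. 4.10,
as in the tree's `hasSliceRankLE_of_cover`): if `D = Σ_ω Fx ω ⊗ Fy ω ⊗ Fz ω` over a finite `Ω` split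
into three classes `c ω ∈ {0,1,2}` such that on class `0` the factor `Fx ω` only depends on
`πx ω ∈ Sx`, on class `1` the factor `Fy ω` only on `πy ω ∈ Sy` and on class `2` the factor `Fz ω`
only on `πz ω ∈ Sz`, then collecting terms gives an `(|Sx|, |Sy|, |Sz|)`-slice decomposition.
[cite: BlasiakChurchCohnGrochowNaslundSawinUmans2017, Thm. 4.10 (proof)] -/
theorem hasSliceDecomp_of_cover {Ω : Type*} [Fintype Ω] (D : X → Y → Z → K)
    (Fx : Ω → X → K) (Fy : Ω → Y → K) (Fz : Ω → Z → K)
    (hD : ∀ x y z, D x y z = ∑ ω, Fx ω x * Fy ω y * Fz ω z) (c : Ω → Fin 3)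
    {Sx Sy Sz : Type*} [Fintype Sx] [Fintype Sy] [Fintype Sz] [DecidableEq Sx] [DecidableEq Sy]
    [DecidableEq Sz]
    (πx : Ω → Sx) (φ : Sx → X → K) (hx : ∀ ω, c ω = 0 → Fx ω = φ (πx ω))
    (πy : Ω → Sy) (χ : Sy → Y → K) (hy : ∀ ω, c ω = 1 → Fy ω = χ (πy ω))
    (πz : Ω → Sz) (ψ : Sz → Z → K) (hz : ∀ ω, c ω = 2 → Fz ω = ψ (πz ω)) :
    HasSliceDecomp D (Fintype.card Sx) (Fintype.card Sy) (Fintype.card Sz) := by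
  classical
  refine hasSliceDecomp_of_fintype D
    φ (fun s y z => ∑ ω ∈ univ.filter (fun ω => c ω = 0 ∧ πx ω = s), Fy ω y * Fz ω z)
    χ (fun s x z => ∑ ω ∈ univ.filter (fun ω => c ω = 1 ∧ πy ω = s), Fx ω x * Fz ω z)
    ψ (fun s x y => ∑ ω ∈ univ.filter (fun ω => c ω = 2 ∧ πz ω = s), Fx ω x * Fy ω y)
    fun x y z => ?_
  rw [hD x y z]
  -- split the sum over the three classes
  have hsplit : ∑ ω, Fx ω x * Fy ω y * Fz ω z =
      (∑ ω ∈ univ.filter (fun ω => c ω = 0), Fx ω x * Fy ω y * Fz ω z) +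
      (∑ ω ∈ univ.filter (fun ω => c ω = 1), Fx ω x * Fy ω y * Fz ω z) +
      (∑ ω ∈ univ.filter (fun ω => c ω = 2), Fx ω x * Fy ω y * Fz ω z) := by
    rw [← Finset.sum_fiberwise_of_maps_to (g := c) (t := (univ : Finset (Fin 3)))
      (fun ω _ => mem_univ _)]
    simp only [Fin.sum_univ_three]
  rw [hsplit]
  congr 1
  congr 1
  · rw [← Finset.sum_fiberwise_of_maps_to (g := πx) (t := (univ : Finset Sx))
      (fun ω _ => mem_univ _)]
    refine Finset.sum_congr rfl fun s _ => ?_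
    rw [Finset.filter_filter, Finset.mul_sum]
    refine Finset.sum_congr rfl fun ω hω => ?_
    obtain ⟨h0, hs⟩ := (mem_filter.1 hω).2
    rw [hx ω h0, hs]; ring
  · rw [← Finset.sum_fiberwise_of_maps_to (g := πy) (t := (univ : Finset Sy))
      (fun ω _ => mem_univ _)]
    refine Finset.sum_congr rfl fun s _ => ?_
    rw [Finset.filter_filter, Finset.mul_sum]
    refine Finset.sum_congr rfl fun ω hω => ?_
    obtain ⟨h0, hs⟩ := (mem_filter.1 hω).2
    rw [hy ω h0, hs]; ring
  · rw [← Finset.sum_fiberwise_of_maps_to (g := πz) (t := (univ : Finset Sz))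
      (fun ω _ => mem_univ _)]
    refine Finset.sum_congr rfl fun s _ => ?_
    rw [Finset.filter_filter, Finset.mul_sum]
    refine Finset.sum_congr rfl fun ω hω => ?_
    obtain ⟨h0, hs⟩ := (mem_filter.1 hω).2
    rw [hz ω h0, hs]; ring

end FieldFacts

end Literature.Barriers.MatrixMultiplication

end
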